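import Summits.QuantumFields.YangMills.Theorems.SwapVirialDeficitNearFlatSigmaProductFloor
import Summits.QuantumFields.YangMills.Theorems.SwapVirialDeficitNearFlatRelations
import Summits.QuantumFields.YangMills.Theorems.SwapVirialDeficitBlowUpGnomonicCommutatorFloor
import Summits.QuantumFields.YangMills.Theorems.SwapVirialDeficitBlowUpPeriodicDominator
import Summits.QuantumFields.YangMills.Theorems.SwapVirialDeficitGnomonicTaylorHubLine
import Summits.QuantumFields.YangMills.Theorems.SwapVirialDeficitBlowUpGnomonicBFibreJets
import HarnessLib

/-!
# THE Σ-PRODUCT FLOOR IN GNOMONIC LETTERS: `F̂(hubAt δ 1, ε, η) ≥ |u|²·(16δ² + 16(|x|²δ² + x₀²)/(1+|x|²) + 4(1+δ²)|y|²/(1+|y|²)) / (39600·L⁶·(1+|x|²)(1+δ²)²)`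
# (free-hands support of ⟨stmt-QuantumFields-24197⟩ `SwapVirialDeficit.SwapGluedStiffness`; LEAD g99 memo8 (Σ2)/memo9: the pointwise floor of the END-CORE weight bound
# `stub_core_end` of skeleton ➎, read from ✓`sigma_product_floor_full_of_le` in the letters of the master chart at the hub `hubAt δ 1`)

For the chart point `q = blowUpPoint 1 (gnomonicPoint (hubAt δ 1) ε η)` (every sign pattern `ε`, every `δ`, letters `x = η.1.1`, `y = η.1.2`, slaving letter `z = η.2.1`):
`ĉ = (δ, 1, 0, 0)/√(1+δ²)`, `Ĉ₀ = ±(1, x)/√(1+|x|²)`, `Ĉ₁ = ĉ⁻¹Ĉ₀ĉ·Ẑ`, `Ĉ₂ = ±(1, y)/√(1+|y|²)` (§1), so the letters of ✓`…NearFlatSigmaProductFloor` read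
`(re ĉ)² = δ²/(1+δ²)`, `‖im ĉ‖² = 1/(1+δ²)`, `‖im Ĉ₀‖² = |x|²/(1+|x|²)`, `⟪im ĉ, im Ĉ₀⟫² = x₀²/((1+δ²)(1+|x|²))`, `‖im Ĉ₂‖² = |y|²/(1+|y|²)` (§2), hence
`T = |u|²/((1+|x|²)(1+δ²))` with `|u|² = x₁² + x₂²` the TRANSVERSE letter (distance to stratum A ∩ End) and the B-bracket
`16δ²/(1+δ²) + 16(|x|²δ² + x₀²)/((1+|x|²)(1+δ²)) + 4|y|²/(1+|y|²)`; with ✓`relations_le_of_chartDeficit` (`m = 60L³√F̂/√2`, `22m² = 39600L⁶F̂`):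
* ★★★ `gnoDeficit_hubAt_ge_sigma_product` — `T · bracket ≤ 39600·L⁶·F̂(hubAt δ 1, ε, η)`, for ALL `δ, ε, η` (no region hypothesis: a global Łojasiewicz inequality with
  the product exponent; on the end core `|δ| ≲ √τ`, so `T ≍ |u|²/(1+|x|²)` and bracket `≍ δ² + x₀²/(1+|x|²) + |y|²/(1+|y|²)` — memo8's `|u|²(k₁δ² + k₂x₀² + k₃y₀²)`).
Integrating `u` first (✓`…SigmaBallModel.lintegral_exp_neg_mul_sq_norm_two_le`) and the bracket by the slab bounds is the END-CORE weight computation (memo8 §2(c));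
the slaving letter and the followers are separately `≥` (✓`norm_sigmaWord_slaved`, ✓`relations_le_of_chartDeficit`).

HONEST LABEL: algebra in the letters of a landed chart; stubs B ∕ core-tip ∕ core-end ∕ 001-good of skeleton ➎ OPEN, ⟨24197⟩ ∕ ⟨24194⟩ ∕ ⟨24497⟩ OPEN; own crux ⟨22884⟩
`LargeFieldMassRefinementTail` OPEN (blocked-on ⟨19935⟩); the Yang–Mills mass gap is NOT proved; no summit is proved by a line.  THEOREMS ONLY (0 `def`, 0 `sorry`),
standard axioms.  LEAD seat ym-line-sfw-p2 g99 (cell ym-idea-1, free hands), `--supports stmt-QuantumFields-24197`.  References: [cite: Luscher1983, §2]; [folklore].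
-/

set_option autoImplicit false

noncomputable section

open Quaternion
open scoped Quaternion RealInnerProductSpace
open Literature.MathematicalPhysics.QuantumFieldTheory hiding SU2
open Literature.MathematicalPhysics.QuantumLattice
open Literature.Analysis.Calculus (radialUnit radialUnit_def norm_radialUnit)
open Literature.MathematicalPhysics.QuantumFieldTheory.DybalskiStottmeisterTanimoto2024.DST24CriticalPoint (inner_eq_components)
open Summit.QuantumFields.YangMills.Theorems.SwapTwistDeficit.ToronLog (axisPoint)
open Summit.QuantumFields.YangMills.Theorems.SwapVirialDeficit.ZeroModeSigma (su2Quat_quatToSU2_eq_radialUnit slaveP norm_axisUnit dil3 dil3_apply)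
open Summit.QuantumFields.YangMills.Theorems.SwapVirialDeficit.BlowUp (leaderTuple dil3_one')
open Summit.QuantumFields.YangMills.Theorems.SwapVirialDeficit.BlowUpRing
open Summit.QuantumFields.YangMills.Theorems.SwapVirialDeficit.Gnomonic

namespace Summit.QuantumFields.YangMills.Theorems.SwapVirialDeficit.NearFlat

open Summit.QuantumFields.YangMills.Theorems.FemtoTransferGap
open Summit.QuantumFields.YangMills.Theorems.FemtoTransferGap.TT
open Summit.QuantumFields.YangMills.Theorems.VirialFluxGap.RingDeficit
open Summit.QuantumFields.YangMills.Theorems.SwapVirialDeficit.SwapRing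

variable {L : ℕ} [NeZero L]

/-! ## §1 The four leaders at the hub `hubAt δ 1` as unit quaternions -/

omit [NeZero L] in
/-- ★ **THE LEADERS IN LETTERS**: for `q = blowUpPoint 1 (gnomonicPoint (hubAt δ 1) ε η)`, with `ĉ := radialUnit (hubAt δ 1)`, `Ĉ₀ := radialUnit (gnoLetter ε.1.1 η.1.1)`,
`Ẑ := radialUnit (gnoLetter ε.2.1 η.2.1)`, `Ĉ₂ := radialUnit (gnoLetter ε.1.2 η.1.2)`:  `Ĉ_k = su2Quat (q.1 k)` are `Ĉ₀, ĉ⁻¹Ĉ₀ĉẐ, Ĉ₂, ĉ`. [folklore] -/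
theorem leaders_hubAt_letters (δ : ℝ) (ε : GnoSign L) (η : GnoCoord L) :
    su2Quat ((blowUpPoint (L := L) 1 (gnomonicPoint (hubAt δ 1) ε η)).1 0) = radialUnit (gnoLetter ε.1.1 η.1.1) ∧
    su2Quat ((blowUpPoint (L := L) 1 (gnomonicPoint (hubAt δ 1) ε η)).1 1) =
      star (radialUnit (hubAt δ 1)) * radialUnit (gnoLetter ε.1.1 η.1.1) * radialUnit (hubAt δ 1) * radialUnit (gnoLetter ε.2.1 η.2.1) ∧
    su2Quat ((blowUpPoint (L := L) 1 (gnomonicPoint (hubAt δ 1) ε η)).1 2) = radialUnit (gnoLetter ε.1.2 η.1.2) ∧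
    su2Quat ((blowUpPoint (L := L) 1 (gnomonicPoint (hubAt δ 1) ε η)).1 3) = radialUnit (hubAt δ 1) := by
  have ha : hubAt δ 1 ≠ 0 := hubAt_one_ne_zero δ
  have hax : axisPoint (hubAt δ 1) = hubAt δ 1 := axisPoint_hubAt δ 1
  have e0 : (blowUpPoint (L := L) 1 (gnomonicPoint (hubAt δ 1) ε η)).1 =
      leaderTuple (hubAt δ 1) ((gnoLetter ε.1.1 η.1.1, gnoLetter ε.1.2 η.1.2), gnoLetter ε.2.1 η.2.1) := by
    show leaderTuple (hubAt δ 1) (dil3 1 (gnomonicPoint (hubAt δ 1) ε η).2.1) = _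
    rw [dil3_one']; rfl
  rw [e0]
  refine ⟨?_, ?_, ?_, ?_⟩
  · rw [(BlowUp.leaderTuple_apply _ _).1]; exact su2Quat_quatToSU2_eq_radialUnit (gnoLetter_ne_zero _ _)
  · rw [(BlowUp.leaderTuple_apply _ _).2.1, su2Quat_quatToSU2_slaveP_mul (norm_axisUnit ha) (gnoLetter_ne_zero _ _) (gnoLetter_ne_zero _ _), hax,
      su2Quat_quatToSU2_eq_radialUnit (gnoLetter_ne_zero _ _), su2Quat_quatToSU2_eq_radialUnit (gnoLetter_ne_zero _ _)]
  · rw [(BlowUp.leaderTuple_apply _ _).2.2.1]; exact su2Quat_quatToSU2_eq_radialUnit (gnoLetter_ne_zero _ _)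
  · rw [(BlowUp.leaderTuple_apply _ _).2.2.2, su2Quat_quatToSU2_axisUnit ha, hax]

/-! ## §2 The letters of the radial units -/

/-- `re` and `im` of a radial unit. [folklore] -/
theorem re_im_radialUnit (v : ℍ) : (radialUnit v).re = ‖v‖⁻¹ * v.re ∧ (radialUnit v).im = ‖v‖⁻¹ • v.im := by
  rw [radialUnit_def, Quaternion.re_smul, Quaternion.im_smul, smul_eq_mul]; exact ⟨rfl, rfl⟩

omit [NeZero L] in
/-- `‖im v‖² = |x|²` for the gnomonic letter `v = ±(1, x)`. [folklore] -/
theorem sq_norm_im_gnoLetter (ε : Bool) (x : Fin 3 → ℝ) : ‖(gnoLetter ε x).im‖ ^ 2 = normSq3 x := by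
  obtain ⟨hI, hJ, hK⟩ := gnoLetter_im ε x
  rw [sq_norm_eq_sum_sq, Quaternion.re_im, Quaternion.imI_im, Quaternion.imJ_im, Quaternion.imK_im, hI, hJ, hK, normSq3, Fin.sum_univ_three]
  have hs : gnoSign ε ^ 2 = 1 := gnoSign_sq ε
  nlinarith [hs]

/-- THE HUB LETTERS: `(re ĉ)² = δ²/(1+δ²)`, `‖im ĉ‖² = 1/(1+δ²)` for `ĉ = radialUnit (hubAt δ 1)`. [folklore] -/
theorem hub_letters (δ : ℝ) :
    (radialUnit (hubAt δ 1)).re ^ 2 = δ ^ 2 * (1 + δ ^ 2)⁻¹ ∧ ‖(radialUnit (hubAt δ 1)).im‖ ^ 2 = (1 + δ ^ 2)⁻¹ := by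
  obtain ⟨hre, him⟩ := re_im_radialUnit (hubAt δ 1)
  obtain ⟨hr, hI, hJ, hK, hn⟩ := hubAt_components (a₀ := δ) zero_le_one
  have hn' : ‖hubAt δ 1‖ ^ 2 = 1 + δ ^ 2 := by rw [hn]; ring
  have hni : ‖(hubAt δ 1).im‖ ^ 2 = 1 := by
    rw [sq_norm_eq_sum_sq, Quaternion.re_im, Quaternion.imI_im, Quaternion.imJ_im, Quaternion.imK_im, hI, hJ, hK, Real.sqrt_one]; norm_num
  refine ⟨?_, ?_⟩
  · rw [hre, hr, mul_pow, inv_pow, hn']; ring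
  · rw [him, norm_smul, norm_inv, norm_norm, mul_pow, inv_pow, hn', hni, mul_one]

omit [NeZero L] in
/-- THE LEADER LETTERS: `‖im Ĉ‖² = |x|²/(1+|x|²)` for `Ĉ = radialUnit (gnoLetter ε x)`. [folklore] -/
theorem leader_letter_sq_norm_im (ε : Bool) (x : Fin 3 → ℝ) : ‖(radialUnit (gnoLetter ε x)).im‖ ^ 2 = normSq3 x * (1 + normSq3 x)⁻¹ := by
  obtain ⟨-, him⟩ := re_im_radialUnit (gnoLetter ε x)
  rw [him, norm_smul, norm_inv, norm_norm, mul_pow, inv_pow, norm_sq_gnoLetter, sq_norm_im_gnoLetter]; ring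

omit [NeZero L] in
/-- THE AXIAL LETTER: `⟪im ĉ, im Ĉ₀⟫² = x₀²/((1+δ²)(1+|x|²))`. [folklore] -/
theorem axial_letter_sq (δ : ℝ) (ε : Bool) (x : Fin 3 → ℝ) :
    ⟪(radialUnit (hubAt δ 1)).im, (radialUnit (gnoLetter ε x)).im⟫ ^ 2 = x 0 ^ 2 * ((1 + δ ^ 2)⁻¹ * (1 + normSq3 x)⁻¹) := by
  obtain ⟨-, himc⟩ := re_im_radialUnit (hubAt δ 1)
  obtain ⟨-, him0⟩ := re_im_radialUnit (gnoLetter ε x)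
  obtain ⟨-, hI, hJ, hK, hn⟩ := hubAt_components (a₀ := δ) zero_le_one
  obtain ⟨gI, gJ, gK⟩ := gnoLetter_im ε x
  have hn' : ‖hubAt δ 1‖ ^ 2 = 1 + δ ^ 2 := by rw [hn]; ring
  have hinner : ⟪(hubAt δ 1).im, (gnoLetter ε x).im⟫ = gnoSign ε * x 0 := by
    rw [inner_eq_components, Quaternion.re_im, Quaternion.imI_im, Quaternion.imJ_im, Quaternion.imK_im, Quaternion.re_im, Quaternion.imI_im,
      Quaternion.imJ_im, Quaternion.imK_im, hI, hJ, hK, gI, Real.sqrt_one]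
    ring
  rw [himc, him0, real_inner_smul_left, real_inner_smul_right, hinner, mul_pow, mul_pow, mul_pow, inv_pow, inv_pow, hn', norm_sq_gnoLetter, gnoSign_sq]
  ring

/-! ## §3 The product floor in letters -/

/-- ★★★ **THE Σ-PRODUCT FLOOR IN GNOMONIC LETTERS** (every `δ`, every sign pattern, every letter): with `x = η.1.1`, `y = η.1.2`, `|u|² = x₁² + x₂²`,
`T · (16δ²/(1+δ²) + 16(|x|²δ² + x₀²)/((1+|x|²)(1+δ²)) + 4|y|²/(1+|y|²)) ≤ 39600·L⁶·F̂(hubAt δ 1, ε, η)`, `T = |u|²/((1+|x|²)(1+δ²))`. [cite: Luscher1983, §2] -/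
theorem gnoDeficit_hubAt_ge_sigma_product (δ : ℝ) (ε : GnoSign L) (η : GnoCoord L) :
    (η.1.1 1 ^ 2 + η.1.1 2 ^ 2) * ((1 + normSq3 η.1.1)⁻¹ * (1 + δ ^ 2)⁻¹) *
        (16 * (δ ^ 2 * (1 + δ ^ 2)⁻¹) + 16 * ((normSq3 η.1.1 * δ ^ 2 + η.1.1 0 ^ 2) * ((1 + normSq3 η.1.1)⁻¹ * (1 + δ ^ 2)⁻¹)) +
          4 * (normSq3 η.1.2 * (1 + normSq3 η.1.2)⁻¹)) ≤
      39600 * (L : ℝ) ^ 6 * gnoDeficit (fun _ => false) (fun _ => 1) (hubAt δ 1) ε η := by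
  -- the chart point and its relations
  obtain ⟨q, hq⟩ : ∃ q : (Fin 4 → SU2) × (Fol L → SU2), blowUpPoint (L := L) 1 (gnomonicPoint (hubAt δ 1) ε η) = q := ⟨_, rfl⟩
  have hF : gnoDeficit (fun _ => false) (fun _ => 1) (hubAt δ 1) ε η = chartDeficit L (fun _ => false) (fun _ => 1) q := by rw [← hq]; rfl
  obtain ⟨hc, hσ, -⟩ := relations_le_of_chartDeficit (L := L) q
  obtain ⟨e0, e1, e2, e3⟩ := leaders_hubAt_letters (L := L) δ ε η
  rw [hq] at e0 e1 e2 e3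
  rw [show (Fin.last 3 : Fin 4) = 3 from rfl] at hσ
  -- names
  obtain ⟨c, hcdef⟩ : ∃ c : ℍ, radialUnit (hubAt δ 1) = c := ⟨_, rfl⟩
  obtain ⟨C₀, hC₀def⟩ : ∃ C : ℍ, radialUnit (gnoLetter ε.1.1 η.1.1) = C := ⟨_, rfl⟩
  obtain ⟨Z, hZdef⟩ : ∃ C : ℍ, radialUnit (gnoLetter ε.2.1 η.2.1) = C := ⟨_, rfl⟩
  obtain ⟨C₂, hC₂def⟩ : ∃ C : ℍ, radialUnit (gnoLetter ε.1.2 η.1.2) = C := ⟨_, rfl⟩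
  have hcu : ‖c‖ = 1 := by rw [← hcdef]; exact norm_radialUnit (hubAt_one_ne_zero δ)
  have hC₀u : ‖C₀‖ = 1 := by rw [← hC₀def]; exact norm_radialUnit (gnoLetter_ne_zero _ _)
  have hZu : ‖Z‖ = 1 := by rw [← hZdef]; exact norm_radialUnit (gnoLetter_ne_zero _ _)
  have hC₂u : ‖C₂‖ = 1 := by rw [← hC₂def]; exact norm_radialUnit (gnoLetter_ne_zero _ _)
  -- the letters (before renaming)
  obtain ⟨hre, himc⟩ := hub_letters δ
  have him0 := leader_letter_sq_norm_im ε.1.1 η.1.1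
  have hg := axial_letter_sq δ ε.1.1 η.1.1
  have him2 := leader_letter_sq_norm_im ε.1.2 η.1.2
  rw [hcdef] at hre himc hg
  rw [hC₀def] at him0 hg
  rw [hC₂def] at him2
  rw [hC₀def] at e0
  rw [hcdef, hC₀def, hZdef] at e1
  rw [hC₂def] at e2
  rw [hcdef] at e3
  obtain ⟨m, hm⟩ : ∃ m : ℝ, 60 * (L : ℝ) ^ 3 * Real.sqrt (chartDeficit L (fun _ => false) (fun _ => 1) q) / Real.sqrt 2 = m := ⟨_, rfl⟩
  rw [hm] at hc hσ
  -- the five relations in quaternion form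
  have h01 : ‖C₀ * (star c * C₀ * c * Z) - (star c * C₀ * c * Z) * C₀‖ ≤ m := by
    have h := hc 0 1
    rw [show (Fin.castSucc (0 : Fin 3) : Fin 4) = 0 from rfl, show (Fin.castSucc (1 : Fin 3) : Fin 4) = 1 from rfl, e0, e1] at h; exact h
  have h02 : ‖C₀ * C₂ - C₂ * C₀‖ ≤ m := by
    have h := hc 0 2
    rw [show (Fin.castSucc (0 : Fin 3) : Fin 4) = 0 from rfl, show (Fin.castSucc (2 : Fin 3) : Fin 4) = 2 from rfl, e0, e2] at h; exact h
  have hs0 : ‖c * (star c * C₀ * c * Z) - C₀ * c‖ ≤ m := by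
    have h := hσ 0
    rw [Equiv.swap_apply_left, show (Fin.castSucc (1 : Fin 3) : Fin 4) = 1 from rfl, show (Fin.castSucc (0 : Fin 3) : Fin 4) = 0 from rfl, e3, e1, e0] at h
    exact h
  have hs1 : ‖c * C₀ - (star c * C₀ * c * Z) * c‖ ≤ m := by
    have h := hσ 1
    rw [Equiv.swap_apply_right, show (Fin.castSucc (0 : Fin 3) : Fin 4) = 0 from rfl, show (Fin.castSucc (1 : Fin 3) : Fin 4) = 1 from rfl, e3, e0, e1] at h
    exact h
  have hs2 : ‖c * C₂ - C₂ * c‖ ≤ m := by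
    have h := hσ 2
    rw [Equiv.swap_apply_of_ne_of_ne (by decide) (by decide), show (Fin.castSucc (2 : Fin 3) : Fin 4) = 2 from rfl, e3, e2] at h
    exact h
  -- the quaternion-side product floor, read in letters
  have hP := sigma_product_floor_full_of_le hcu hC₀u hC₂u hZu h01 h02 hs0 hs1 hs2
  rw [hre, himc, him0, hg, him2] at hP
  -- `22m² = 39600L⁶F̂`
  have hF0 : 0 ≤ chartDeficit L (fun _ => false) (fun _ => 1) q := chartDeficit_nonneg _ _ q
  have hm2 : 22 * m ^ 2 = 39600 * (L : ℝ) ^ 6 * chartDeficit L (fun _ => false) (fun _ => 1) q := by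
    rw [← hm, div_pow, mul_pow, mul_pow, Real.sq_sqrt hF0, Real.sq_sqrt (by norm_num : (0:ℝ) ≤ 2)]; ring
  rw [hF, ← hm2]
  refine le_trans (le_of_eq ?_) hP
  have hpos : (1 + δ ^ 2) ≠ 0 := by positivity
  have hposx : (1 + normSq3 η.1.1) ≠ 0 := by have := normSq3_nonneg η.1.1; positivity
  have hnx : normSq3 η.1.1 = η.1.1 0 ^ 2 + η.1.1 1 ^ 2 + η.1.1 2 ^ 2 := by rw [normSq3, Fin.sum_univ_three]
  rw [hnx] at hposx ⊢
  field_simp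
  ring

end Summit.QuantumFields.YangMills.Theorems.SwapVirialDeficit.NearFlat

end
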